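import Literature.IUT.HodgeTheaters.PMBaseProp67AlgorithmSub
import Literature.IUT.HodgeTheaters.PMBaseStripsProofs
import Literature.IUT.HodgeTheaters.PMBaseModelsProofs
import HarnessLib

/-!
# [IUTchI] Proposition 6.7 — the two printed CORRESPONDENCES, and Definition 6.4 (i)'s identification of
# the fibre components of `†𝔇_T ↠ †𝔇_{|T|}` (sub-DAG rows P67-L01 / P67-L00; proof-only, 0 defs)

S. Mochizuki, *Inter-universal Teichmüller theory I*, kurims manuscript (May 2020), §6: Proposition 6.7
p. 167 l.29–32 ("Thus, the newly constructed `𝒟-Θ`-bridge is related to the given `𝒟-Θ^±`-bridge via the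
following correspondences: `†𝔇_T|_{(T∖{0})} ↦ †𝔇_{T^⋇}`; `†𝔇_0, †𝔇_≻ ↦ †𝔇_>` — each of which maps
precisely two `𝒟`-prime-strips to a single `𝒟`-prime-strip") and Definition 6.4 (i) p. 162 l.27–34
("`†𝔇_{|T|}` … the `l^±`-capsule obtained from the `l`-capsule `†𝔇_T` by forming the quotient `|T|` of
the index set `T` … by the action of `{±1}` and identifying the components of the capsule `†𝔇_T` indexed
by the elements in the fibers of the quotient `T ↠ |T|` via the constituent poly-morphisms of
`†φ^{Θ±}_± = {†φ^{Θ±}_t}_{t∈T}` [so each constituent `𝒟`-prime-strip of `†𝔇_{|T|}` is only well-defined up to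
a positive automorphism, but this indeterminacy will not affect applications of this construction —
cf. Propositions 6.7; 6.8, (ii); 6.9, (i), below]") [claim: Mochizuki2012, status: disputed] (D-0012
claim key; series status DISPUTED — this file is label/poly-morphism bookkeeping over the §6 base kit and
asserts nothing about any disputed step; no side is taken on [IUTchIII] Cor 3.12).

abc-iut-L5-t4 realises `†𝔇_{|T|}` / `†𝔇_{T^⋇}` by a CHOSEN representative of each fibre
(`DThetaPMBridge.absCapsule q := capsule (Quotient.out q)`, `starCapsule`).  This file records, as kernel
theorems and with no new definition, the printed content behind that choice:

* (C1) the index map `T∖{0} → T^⋇`, `t ↦ |t|`, is onto and EXACTLY two-to-one for `l` odd: every fibre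
  of `T ↠ |T|` over a nonzero class is `{t, −t}` with `t ≠ −t` (`card_toAbs_fibre = 2`), the fibre over
  `|0|` is `{0}` (`card_toAbs_fibre_zero = 1`), `#T = l`, `#(T∖{0}) = 2·l^⋇` — "maps precisely two
  `𝒟`-prime-strips to a single `𝒟`-prime-strip" for `†𝔇_T|_{(T∖{0})} ↦ †𝔇_{T^⋇}`;
* (C2) Definition 6.4 (i)'s identification of two fibre components `†𝔇_t ⥲ †𝔇_{t'}` "via the constituent
  poly-morphisms", i.e. the composite poly-isomorphism `†φ^{Θ±}_t · (†φ^{Θ±}_{t'})⁻¹`, IS a `+`-full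
  poly-isomorphism (an `Aut_+`-torsor: "only well-defined up to a positive automorphism"); in particular
  abc-iut-L5-t4's representative `starCapsule q` is `+`-fully poly-isomorphic to every component in its
  fibre — the printed "indeterminacy [that] will not affect applications";
* (C3) `†𝔇_0, †𝔇_≻ ↦ †𝔇_>`: `†𝔇_> := †𝔇_≻` (abc-iut-L5-t4's `thetaBridgeData`, definitional) and
  `†φ^{Θ±}_0 : †𝔇_0 ⥲ †𝔇_≻` is a `+`-full poly-isomorphism (abc-iut-w5-d228's `exists_mem_poly` gives a member).

Everything is proved over `PMBaseBridges` / `PMBaseProcessionsProofs` / `PMBaseModelsProofs`; hypotheses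
sit in the declaration headers; no `Prop` fact, no side taken on [IUTchIII] Cor 3.12.
-/

namespace Literature.IUT.HodgeTheaters

open CategoryTheory

universe u

namespace PMBaseKit

variable {l : ℕ} {K : PMBaseKit.{u} l}

/-! ### A lemma on `+`-full poly-isomorphisms: `(φ · Aut_+) · (ψ · Aut_+)⁻¹ = (φ ∘ ψ⁻¹) · Aut_+` -/

namespace DStrip

variable {D₁ D₂ D₃ : K.DStrip}

/-- Composing the `+`-full poly-isomorphism through `φ : 𝔇₁ ⥲ 𝔇₂` with the INVERSES of the members of
the `+`-full poly-isomorphism through `ψ : 𝔇₃ ⥲ 𝔇₂` gives the `+`-full poly-isomorphism through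
`φ ∘ ψ⁻¹ : 𝔇₁ ⥲ 𝔇₃` ([IUTchI] §0 p. 33 composites of poly-morphisms; Def 6.1 (iv) p. 157: members of a
`+`-full poly-isomorphism induce the same bijections of `±`-label classes).
([IUTchI] Def 6.1 (iv) p.157) [claim: Mochizuki2012, status: disputed] -/
theorem polyComp_plusFullPolyIso_inv (φ : D₁.Iso D₂) (ψ : D₃.Iso D₂) :
    DStrip.polyComp (DStrip.plusFullPolyIso φ) {g' | ∃ g ∈ DStrip.plusFullPolyIso ψ, g' = g.symm} =
      DStrip.plusFullPolyIso (φ.trans ψ.symm) := by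
  ext h
  constructor
  · rintro ⟨f, hf, g', ⟨g, hg, rfl⟩, rfl⟩
    rw [mem_plusFullPolyIso_iff] at hf hg ⊢
    intro v
    change K.labMap v (f v ≪≫ (g v).symm) = K.labMap v (φ v ≪≫ (ψ v).symm)
    rw [K.labMap_trans, K.labMap_trans, labMap_symm, labMap_symm, hf v, hg v]
  · intro hh
    rw [mem_plusFullPolyIso_iff] at hh
    refine ⟨h.trans ψ, mem_plusFullPolyIso_iff.mpr fun v => ?_, ψ.symm, ⟨ψ, self_mem_plusFullPolyIso ψ, rfl⟩,
      funext fun v => ?_⟩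
    · have hv := hh v
      change K.labMap v (h v) = K.labMap v (φ v ≪≫ (ψ v).symm) at hv
      change K.labMap v (h v ≪≫ ψ v) = K.labMap v (φ v)
      rw [K.labMap_trans, hv, K.labMap_trans, labMap_symm, Equiv.trans_assoc, Equiv.symm_trans_self,
        Equiv.trans_refl]
    · change h v = (h v ≪≫ ψ v) ≪≫ (ψ v).symm
      simp

end DStrip

namespace DThetaPMBridge

variable (B : K.DThetaPMBridge)

/-! ### (C1) `†𝔇_T|_{(T∖{0})} ↦ †𝔇_{T^⋇}` maps precisely two `𝒟`-prime-strips to a single one -/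

/-- The fibre of `T ↠ |T|` through `t` is `{t, −t}` ([IUTchI] Def 6.4 (i) p. 162 "the quotient `|T|` of the
index set `T` … by the action of `{±1}`"). ([IUTchI] Def 6.4 (i) p.162) [claim: Mochizuki2012, status: disputed] -/
theorem toAbs_fibre_eq (t : B.T) :
    {t' : B.T | B.grpT.toAbs t' = B.grpT.toAbs t} = {t, B.grpT.neg t} := by
  ext t'
  simp only [Set.mem_setOf_eq, Set.mem_insert_iff, Set.mem_singleton_iff]
  rw [eq_comm, FlPMGroup.toAbs_eq_toAbs_iff]

/-- Every nonzero class `q ∈ T^⋇` has a representative in `T ∖ {0}` (indeed all its representatives are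
nonzero): the index map `T∖{0} → T^⋇` of the correspondence `†𝔇_T|_{(T∖{0})} ↦ †𝔇_{T^⋇}` is ONTO.
([IUTchI] Prop 6.7 p.167) [claim: Mochizuki2012, status: disputed] -/
theorem exists_ne_zero_toAbs_eq (q : B.grpT.AbsStar) :
    ∃ t : B.T, t ≠ B.grpT.zero ∧ B.grpT.toAbs t = q.1 := by
  obtain ⟨t, ht⟩ := B.grpT.toAbs_surjective q.1
  exact ⟨t, fun h => q.2 (by rw [← ht, h]), ht⟩

/-- A representative of a nonzero class is nonzero. ([IUTchI] Def 6.4 (i) p.162) [claim: Mochizuki2012, status: disputed] -/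
theorem ne_zero_of_toAbs_eq (q : B.grpT.AbsStar) {t : B.T} (ht : B.grpT.toAbs t = q.1) :
    t ≠ B.grpT.zero := fun h => q.2 (by rw [← ht, h])

/-- **"precisely two"**: for `l` odd, the fibre of `T∖{0} → T^⋇` over every nonzero class has EXACTLY two
elements `{t, −t}`, `t ≠ −t` — the correspondence `†𝔇_T|_{(T∖{0})} ↦ †𝔇_{T^⋇}` of Prop 6.7 "maps precisely
two `𝒟`-prime-strips to a single `𝒟`-prime-strip". ([IUTchI] Prop 6.7 p.167) [claim: Mochizuki2012, status: disputed] -/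
theorem card_toAbs_fibre (hl : Odd l) (q : B.grpT.AbsStar) :
    Nat.card {t : B.T // B.grpT.toAbs t = q.1} = 2 := by
  obtain ⟨t, ht0, ht⟩ := B.exists_ne_zero_toAbs_eq q
  have hset : {t' : B.T | B.grpT.toAbs t' = q.1} = {t, B.grpT.neg t} := by
    rw [← ht]; exact B.toAbs_fibre_eq t
  have hne : t ≠ B.grpT.neg t := fun h => B.neg_ne_self_of_ne_zero hl ht0 h.symm
  change Nat.card ({t' : B.T | B.grpT.toAbs t' = q.1} : Set B.T) = 2
  rw [hset, Nat.card_coe_set_eq, Set.ncard_pair hne]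

/-- The fibre over the class `|0|` is the single element `0` (`−0 = 0`): the component `†𝔇_0` is the one
strip of `†𝔇_T` that does not go to `†𝔇_{T^⋇}` (it goes to `†𝔇_>`, second correspondence).
([IUTchI] Prop 6.7 p.167) [claim: Mochizuki2012, status: disputed] -/
theorem card_toAbs_fibre_zero :
    Nat.card {t : B.T // B.grpT.toAbs t = B.grpT.toAbs B.grpT.zero} = 1 := by
  have hset : {t' : B.T | B.grpT.toAbs t' = B.grpT.toAbs B.grpT.zero} = {B.grpT.zero} := by
    rw [B.toAbs_fibre_eq, FlPMGroup.neg_zero, Set.pair_eq_singleton]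
  change Nat.card ({t' : B.T | B.grpT.toAbs t' = B.grpT.toAbs B.grpT.zero} : Set B.T) = 1
  rw [hset, Nat.card_coe_set_eq, Set.ncard_singleton]

/-- The index set `T` of a `𝒟-Θ^±`-bridge has exactly `l` elements ("`T` is an `𝔽_l^±`-group", Def 6.4 (i);
the model identification `𝔽_l ⥲ T`). ([IUTchI] Def 6.4 (i) p.162) [claim: Mochizuki2012, status: disputed] -/
theorem card_T (hl : Odd l) : Nat.card B.T = l := by
  obtain ⟨ι, -, -, -, -⟩ := B.exists_model
  have h0 : l ≠ 0 := fun h => by rw [h] at hl; exact (by decide : ¬ Odd 0) hl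
  haveI : NeZero l := ⟨h0⟩
  rw [← Nat.card_congr ι, Nat.card_zmod]

/-- **"precisely two … to a single"**, globally: `T ∖ {0}` has exactly `2·l^⋇` elements while `T^⋇` has
`l^⋇` (abc-iut-w4-d076's `card_absStar`) — the correspondence `†𝔇_T|_{(T∖{0})} ↦ †𝔇_{T^⋇}` is two-to-one
onto. ([IUTchI] Prop 6.7 p.167) [claim: Mochizuki2012, status: disputed] -/
theorem card_ne_zero (hl : Odd l) : Nat.card {t : B.T // t ≠ B.grpT.zero} = 2 * lStar l := by
  classical
  have h1 : Nat.card {t : B.T // t ≠ B.grpT.zero} = Nat.card B.T - 1 := by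
    rw [Nat.card_eq_fintype_card, Nat.card_eq_fintype_card, Fintype.card_subtype_compl,
      Fintype.card_subtype_eq]
  rw [h1, B.card_T hl]
  obtain ⟨k, rfl⟩ := hl
  simp only [lStar]
  omega

/-- The two counts together: `#(T∖{0}) = 2 · #T^⋇`. ([IUTchI] Prop 6.7 p.167) [claim: Mochizuki2012, status: disputed] -/
theorem card_ne_zero_eq_two_mul_card_absStar (hl : Odd l) :
    Nat.card {t : B.T // t ≠ B.grpT.zero} = 2 * Nat.card B.grpT.AbsStar := by
  rw [B.card_ne_zero hl, B.card_absStar hl]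

/-! ### (C2) Definition 6.4 (i): the identification of fibre components is a `+`-full poly-isomorphism -/

/-- Every constituent `†φ^{Θ±}_t : †𝔇_t ⥲ †𝔇_≻` of a `𝒟-Θ^±`-bridge is a `+`-full poly-isomorphism (a conjugate
of Example 6.2 (i)'s positive `+`-full poly-automorphism `Aut_+`, Def 6.4 (i) "conjugation by which maps
`φ^{Θ±}_± ↦ †φ^{Θ±}_±`"). ([IUTchI] Def 6.4 (i) p.162) [claim: Mochizuki2012, status: disputed] -/
theorem poly_isPlusFullPolyIso (t : B.T) : DStrip.IsPlusFullPolyIso (B.poly t) := by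
  obtain ⟨ι, -, α, β, hpoly⟩ := B.exists_model
  obtain ⟨z, rfl⟩ := ι.surjective t
  have h62 : Ex62.poly K z = DStrip.plusFullPolyIso (DStrip.Iso.refl (DStrip.model K)) :=
    DStrip.signedPolyAut_eq_plusFullPolyIso (DStrip.refl_mem_signedPolyAut_one _)
  refine ⟨((α z).symm.trans (DStrip.Iso.refl _)).trans β, ?_⟩
  rw [hpoly z, h62, DStrip.polyConj_plusFullPolyIso]
  rfl

/-- **[IUTchI] Def 6.4 (i), the identification inside a fibre** (p. 162 l.27–34): for two indices `t, t'`
the composite poly-isomorphism `†φ^{Θ±}_t · (†φ^{Θ±}_{t'})⁻¹ : †𝔇_t ⥲ †𝔇_{t'}` ("identifying the components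
… via the constituent poly-morphisms of `†φ^{Θ±}_±`") is a `+`-FULL poly-isomorphism, i.e. a single
`Aut_+(†𝔇_{t'})`-orbit — "so each constituent `𝒟`-prime-strip of `†𝔇_{|T|}` is only well-defined up to a
positive automorphism".  (Stated for all `t, t'`; print applies it to `t' = ±t`.)
([IUTchI] Def 6.4 (i) p.162) [claim: Mochizuki2012, status: disputed] -/
theorem fibreIdentification_isPlusFullPolyIso (t t' : B.T) :
    DStrip.IsPlusFullPolyIso
      (DStrip.polyComp (B.poly t) {g' : B.codomain.Iso (B.capsule t') | ∃ g ∈ B.poly t', g' = g.symm}) := by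
  obtain ⟨φ, hφ⟩ := B.poly_isPlusFullPolyIso t
  obtain ⟨ψ, hψ⟩ := B.poly_isPlusFullPolyIso t'
  refine ⟨φ.trans ψ.symm, ?_⟩
  change DStrip.polyComp (B.poly t) {g' | ∃ g ∈ B.poly t', g' = g.symm} =
    DStrip.plusFullPolyIso (φ.trans ψ.symm)
  rw [show B.poly t = DStrip.plusFullPolyIso φ from hφ, show B.poly t' = DStrip.plusFullPolyIso ψ from hψ]
  exact DStrip.polyComp_plusFullPolyIso_inv φ ψ

/-- The identification poly-isomorphism between two fibre components is NONEMPTY (so the components are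
isomorphic `𝒟`-prime-strips). ([IUTchI] Def 6.4 (i) p.162) [claim: Mochizuki2012, status: disputed] -/
theorem fibreIdentification_nonempty (t t' : B.T) :
    (DStrip.polyComp (B.poly t)
      {g' : B.codomain.Iso (B.capsule t') | ∃ g ∈ B.poly t', g' = g.symm}).Nonempty := by
  obtain ⟨χ, hχ⟩ := B.fibreIdentification_isPlusFullPolyIso t t'
  refine ⟨χ, ?_⟩
  rw [show DStrip.polyComp (B.poly t) {g' | ∃ g ∈ B.poly t', g' = g.symm} = DStrip.plusFullPolyIso χ from hχ]
  exact DStrip.self_mem_plusFullPolyIso χ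

/-- **abc-iut-L5-t4's representative is harmless**: for a nonzero class `q ∈ T^⋇` and ANY `t` in its fibre,
the component `†𝔇_t` is identified with the chosen constituent `†𝔇_{T^⋇, q} = †𝔇_{out q}` of
`starCapsule` by the `+`-full poly-isomorphism `†φ^{Θ±}_t · (†φ^{Θ±}_{out q})⁻¹` of Def 6.4 (i) — "this
indeterminacy will not affect applications of this construction — cf. Propositions 6.7; 6.8, (ii); 6.9,
(i)". ([IUTchI] Def 6.4 (i) p.162) [claim: Mochizuki2012, status: disputed] -/
theorem starCapsule_identification_isPlusFullPolyIso (q : B.grpT.AbsStar) (t : B.T)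
    (_ht : B.grpT.toAbs t = q.1) :
    DStrip.IsPlusFullPolyIso
      (DStrip.polyComp (B.poly t)
        {g' : B.codomain.Iso (B.starCapsule q) | ∃ g ∈ B.poly (Quotient.out q.1), g' = g.symm}) :=
  B.fibreIdentification_isPlusFullPolyIso t (Quotient.out q.1)

/-- The chosen representative index `out q` lies in the fibre of `q`, and so does its negative: the two
strips `†𝔇_{out q}`, `†𝔇_{−out q}` are the "precisely two" mapped to `†𝔇_{T^⋇, q}`.
([IUTchI] Prop 6.7 p.167) [claim: Mochizuki2012, status: disputed] -/
theorem toAbs_out_eq (q : B.grpT.AbsStar) :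
    B.grpT.toAbs (Quotient.out q.1) = q.1 ∧ B.grpT.toAbs (B.grpT.neg (Quotient.out q.1)) = q.1 := by
  refine ⟨Quotient.out_eq q.1, ?_⟩
  rw [FlPMGroup.toAbs_neg]
  exact Quotient.out_eq q.1

/-! ### (C3) `†𝔇_0, †𝔇_≻ ↦ †𝔇_>` -/

/-- **The second correspondence** `†𝔇_0, †𝔇_≻ ↦ †𝔇_>` ([IUTchI] Prop 6.7 p. 167 l.14–16, l.31: "identifying
the `𝒟`-prime-strip `†𝔇_≻` with the `𝒟`-prime-strip `†𝔇_0` via `†φ^{Θ±}_0` … to form a `𝒟`-prime-strip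
`†𝔇_>`"): `†𝔇_> := †𝔇_≻` in abc-iut-L5-t4's `thetaBridgeData` (definitionally), and the identification
`†φ^{Θ±}_0 : †𝔇_0 ⥲ †𝔇_>` is a `+`-full poly-isomorphism (one `Aut_+`-orbit; a member is abc-iut-w5-d228's
`exists_mem_poly`). ([IUTchI] Prop 6.7 p.167) [claim: Mochizuki2012, status: disputed] -/
theorem zero_codomain_identification (M : K.MultKit) (hl : Odd l) :
    (B.thetaBridgeData M hl).codomain = B.codomain ∧
      DStrip.IsPlusFullPolyIso (B.poly B.grpT.zero) ∧ (B.poly B.grpT.zero).Nonempty :=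
  ⟨rfl, B.poly_isPlusFullPolyIso _, let ⟨f, hf⟩ := B.exists_mem_poly B.grpT.zero; ⟨f, hf⟩⟩

/-- **The index set of Prop 6.7's output is `T^⋇`** and its capsule IS `†𝔇_{T^⋇}` (abc-iut-L5-t4,
definitional): recorded so that (C1)–(C2) literally concern the output of the algorithm.
([IUTchI] Prop 6.7 p.167) [claim: Mochizuki2012, status: disputed] -/
theorem thetaBridgeData_capsule (M : K.MultKit) (hl : Odd l) (q : ULift.{u} B.grpT.AbsStar) :
    (B.thetaBridgeData M hl).capsule q = B.starCapsule q.down ∧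
      B.starCapsule q.down = B.capsule (Quotient.out q.down.1) :=
  ⟨rfl, rfl⟩

end DThetaPMBridge

end PMBaseKit

end Literature.IUT.HodgeTheaters
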